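import Summits.Ventures.HodgeRepro2.T5SU11KernelDerivative
import Summits.Ventures.HodgeRepro2.T5SU11KernelCompositionStrictSign

/-!
# The diagonal of the composed kernel is the square-integral of the kernel's row:
`(K_λ ∘ K_λ)(t, t) = ∫ K_λ(t, r)² sinh 2r dr = ∂_μ K_μ(t, t) > 0`

The kernel is symmetric, so the composed kernel on the diagonal is the `L²(sinh 2r dr)`-norm of the row `K_λ(t, ·)`:

* `integral_kernel_sq_eq_comp` — **`∫ K_λ(t, r)² sinh 2r dr = (K_λ ∘ K_λ)(t, t) = G^I_λ K_λ(·, t)(t)`**;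
* `integrableOn_kernel_sq` — the row `K_λ(t, ·)` is square-integrable against `sinh 2r dr`;
* `hasDerivAt_kernel_diagonal_mu` — **`∂_μ K_μ(t, t) = ∫ K_λ(t, r)² sinh 2r dr`**: the derivative of the diagonal Green's function in
  the spectral parameter is the square-integral of its row (row 575's `∂_μ K = K ∘ K` on the diagonal);
* `kernel_diagonal_strictMonoOn_mu`, `integral_kernel_sq_pos` — **`μ ↦ K_μ(t, t)` is strictly increasing and
  `∫ K_λ(t, r)² sinh 2r dr > 0`** (row 594's strict sign).

Nothing is claimed about (N).

Blind lane: Mathlib + the HodgeRepro2 prefix only; no sorry; axioms ⊆ {propext, Classical.choice,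
Quot.sound}.
-/

namespace Summit.Ventures.HodgeRepro2.T5SU11KernelDiagonalDerivative

open Filter Topology MeasureTheory
open Set (Ioi Ioc)
open T5SU11Cartan T5SU11SphericalFunction T5SU11SphericalDecay T5SU11RadialGreenKernel T5SU11RadialGreenImproper
  T5SU11RadialGreenImproperDecaySource T5SU11ResolventKernelComposition T5SU11KernelDifferenceRegularity
  T5SU11KernelDerivative T5SU11KernelCompositionStrictSign

section measure

variable [MeasurableSpace Circle] [BorelSpace Circle]

variable {lam : ℝ} (hlam : 1 < lam)

include hlam in
/-- **`∫ K_λ(t, r)² sinh 2r dr = G^I_λ K_λ(·, t)(t)`**, the composed kernel on the diagonal. -/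
theorem integral_kernel_sq_eq_comp {t : ℝ} (ht : 0 < t) :
    ∫ r in Ioi 0, sphGreenKernel lam t r ^ 2 * Real.sinh (2 * r)
      = greenSolI (fun t => sph lam (hyp t)) (sphDecay lam) (fun r => sphGreenKernel lam r t) t := by
  rw [greenSolI_kernel_source_eq_integral hlam ht ht]
  apply setIntegral_congr_fun measurableSet_Ioi
  intro r _
  dsimp only
  rw [sphGreenKernel_symm lam r t]
  ring

include hlam in
/-- **The row `K_λ(t, ·)` is square-integrable against `sinh 2r dr`.** -/
theorem integrableOn_kernel_sq {t : ℝ} (ht : 0 < t) :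
    IntegrableOn (fun r => sphGreenKernel lam t r ^ 2 * Real.sinh (2 * r)) (Ioi 0) := by
  obtain ⟨M, hM0, hM⟩ := kernel_source_bounded hlam ht
  obtain ⟨C, s₀, hC⟩ := kernel_source_decay hlam ht
  have hg := kernel_source_continuousOn hlam ht
  have hA := integrableOn_sphDecay_mul_mul_sinh hlam hg hM hM0 (by linarith : 2 - lam < lam) hC
  have hB := integrableOn_sph_mul_mul_sinh_Ioc hg hM hM0 lam
  -- `K_λ(t, r) K_λ(r, t) sinh 2r` is the integrand of the improper formula split at `t`
  have h1 : IntegrableOn (fun r => sphGreenKernel lam t r * sphGreenKernel lam r t * Real.sinh (2 * r)) (Ioc 0 t) := by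
    have : ∀ r ∈ Ioc (0 : ℝ) t, sphGreenKernel lam t r * sphGreenKernel lam r t * Real.sinh (2 * r)
        = -sphDecay lam t * (sph lam (hyp r) * sphGreenKernel lam r t * Real.sinh (2 * r)) := by
      intro r hr
      unfold sphGreenKernel
      rw [greenKernel_of_le _ _ hr.2]
      ring
    have h1' : IntegrableOn (fun x => -sphDecay lam t * (sph lam (hyp x) * sphGreenKernel lam x t * Real.sinh (2 * x)))
        (Ioc 0 t) := (hB t).const_mul _
    exact h1'.congr_fun (fun r hr => (this r hr).symm) measurableSet_Ioc
  have h2 : IntegrableOn (fun r => sphGreenKernel lam t r * sphGreenKernel lam r t * Real.sinh (2 * r)) (Ioi t) := by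
    have : ∀ r ∈ Ioi t, sphGreenKernel lam t r * sphGreenKernel lam r t * Real.sinh (2 * r)
        = -sph lam (hyp t) * (sphDecay lam r * sphGreenKernel lam r t * Real.sinh (2 * r)) := by
      intro r hr
      unfold sphGreenKernel
      rw [greenKernel_of_ge _ _ (le_of_lt hr)]
      ring
    have h2' : IntegrableOn (fun x => -sph lam (hyp t) * (sphDecay lam x * sphGreenKernel lam x t * Real.sinh (2 * x)))
        (Ioi t) := (hA.mono_set (Set.Ioi_subset_Ioi ht.le)).const_mul _
    exact h2'.congr_fun (fun r hr => (this r hr).symm) measurableSet_Ioi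
  have h := h1.union h2
  rw [Set.Ioc_union_Ioi_eq_Ioi ht.le] at h
  refine h.congr_fun (fun r _ => ?_) measurableSet_Ioi
  dsimp only
  rw [sphGreenKernel_symm lam r t]
  ring

include hlam in
/-- **`∂_μ K_μ(t, t) = ∫ K_λ(t, r)² sinh 2r dr`**: the derivative of the diagonal Green's function in the spectral parameter is
the square-integral of its row. -/
theorem hasDerivAt_kernel_diagonal_mu {t : ℝ} (ht : 0 < t) :
    HasDerivAt (fun μ => sphGreenKernel (1 + Real.sqrt (μ + 1)) t t)
      (∫ r in Ioi 0, sphGreenKernel lam t r ^ 2 * Real.sinh (2 * r)) (lam * (lam - 2)) := by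
  have h := hasDerivAt_sphGreenKernel_mu hlam ht ht
  refine h.congr_deriv ?_
  apply setIntegral_congr_fun measurableSet_Ioi
  intro r _
  dsimp only
  rw [sphGreenKernel_symm lam r t]
  ring

include hlam in
/-- **`∫ K_λ(t, r)² sinh 2r dr > 0`** (row 594's strict sign of `K ∘ K`). -/
theorem integral_kernel_sq_pos {t : ℝ} (ht : 0 < t) :
    0 < ∫ r in Ioi 0, sphGreenKernel lam t r ^ 2 * Real.sinh (2 * r) := by
  rw [integral_kernel_sq_eq_comp hlam ht]
  have h := kernel_comp_sign_pos hlam ht 1 ht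
  simpa only [Function.iterate_one, pow_succ, pow_zero, one_mul, neg_one_mul, neg_neg, mul_neg] using h

end measure

end Summit.Ventures.HodgeRepro2.T5SU11KernelDiagonalDerivative
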